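import Mathlib.Analysis.SpecialFunctions.Bernstein
import Mathlib.MeasureTheory.Constructions.BorelSpace.Metrizable
import Literature.Probability.RandomPlanarGeometry.LoewnerInverse
import Literature.Probability.RandomPlanarGeometry.LoewnerTraceLimit
import Literature.Probability.RandomPlanarGeometry.SLEExistenceProofs
import HarnessLib

/-!
# Measurability of the SLE trace; existence of chordal SLE from the three trace theorems

Trunk T-STOCH. We **prove** the named fact `Literature.Probability.RandomPlanarGeometry.aemeasurable_sleTrace`
(`Literature/Probability/RandomPlanarGeometry/SLEExistence.lean`): if SLE_κ is a.s. generated by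
a curve, then each marginal `ω ↦ γ(t)` of the trace is an a.e.-measurable function of the
Brownian path — Rohde–Schramm (2005), §3 p. 896 ("for every `s`, the map `f̂ₛ` is measurable with
respect to the σ-field generated by `ξ(t)`, `t ∈ [0,s]`") combined with the identification of
the tip `γ(t) = lim_{z → 0} f̂ₜ(z)`.

* *Identification* (deterministic, `LoewnerTraceLimit.lean`): on the event that the chain of
  `W = √κ B(ω)` is generated by a curve, `sleTrace κ ω t = limₙ fₜ(Wₜ + i/(n+1))` where
  `fₜ = gₜ⁻¹` is the backward Loewner flow (`IsGeneratedByCurve.tendsto_invFunOn_map_seq`).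
* *Stability of the backward flow in the driving function* (`norm_loewnerInvAt_sub_le`): by
  Grönwall's inequality (Mathlib `dist_le_of_approx_trajectories_ODE`) for the truncated backward
  field of `LoewnerFlow.lean` (globally `2/m²`-Lipschitz), the functional
  `loewnerInvAt t y U = f^U_t(U(t) + iy)` (in terms of `Literature.Probability.RandomPlanarGeometry.Loewner.loewnerInv` of
  `LoewnerInverse.lean`) is Lipschitz in `U` for the sup-distance on `[0, t]`.
* *Finite-dimensional approximation*: the Bernstein polynomial `Bₙ U` of the driving function on
  `[0, t]` depends continuously on the finitely many values `U(tk/N)` (`bernDriverFun`), and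
  `Bₙ U → U` uniformly (Mathlib `bernsteinApproximation_uniform`); so `ω ↦ f^{BₙW(ω)}_t(·)` is
  measurable (continuous function of finitely many Brownian marginals) and converges to
  `ω ↦ fₜ(Wₜ(ω) + iy)` everywhere, which is therefore measurable (`measurable_loewnerInvAt_sleDriving`).
* Hence `aemeasurable_sleTrace_holds`, and, with `exists_isSLECurve_of_sle_facts`
  (`SLEExistenceProofs.lean`), **`Literature.Probability.RandomPlanarGeometry.exists_isSLECurve` follows from the three SLE trace
  theorems alone**: SLE₈ is generated by a curve (Lawler–Schramm–Werner (2004), Thm. 4.7),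
  SLE_κ, `κ ≠ 8`, is generated by a curve (Rohde–Schramm (2005), Thm. 5.1) and the trace is
  transient (Rohde–Schramm (2005), Thm. 7.1): `exists_isSLECurve_of_trace_theorems`.

## References

* S. Rohde, O. Schramm, *Basic properties of SLE*, Ann. of Math. 161 (2005), §3 (p. 896),
  Thm. 3.6, Thm. 4.1, Thm. 5.1, Thm. 7.1.
* G. F. Lawler, *Conformally Invariant Processes in the Plane*, AMS (2005), §4.1, §4.4.
-/

noncomputable section

open Set Filter Topology Metric Complex MeasureTheory
open scoped NNReal

namespace Literature.Probability.RandomPlanarGeometry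

namespace Loewner

/-! ### The functional `U ↦ fₜ^U(U(t) + iy)` and its stability in `U` -/

/-- `loewnerInvAt t y U = f^U_t (U t + i y) = loewnerInv U t (U t + i y)`: the inverse Loewner
map `fₜ = gₜ⁻¹` of the driving function `U` (`Literature.Probability.RandomPlanarGeometry.Loewner.loewnerInv`, file `LoewnerInverse`),
evaluated at the point `i y` above the driving value, viewed as a functional of `U` (so that,
for the SLE_κ trace, `γ(t) = limₙ loewnerInvAt t (1/(n+1)) W`). Junk value for `y ≤ 0` (the
point is then off `ℍₒ` and `Function.invFunOn` returns an arbitrary point); all lemmas assume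
`0 < y`. Lawler (2005), Ch. 4 §4.1 (`fₜ = gₜ⁻¹`). [cite: Lawler2005, Ch. 4 §4.1] -/
def loewnerInvAt (t : ℝ≥0) (y : ℝ) (U : ℝ≥0 → ℝ) : ℂ :=
  loewnerInv U t ((U t : ℂ) + I * y)

/-- Unfolding: `loewnerInvAt t y U = Function.invFunOn (map U t) (domain U t) (U t + i y)`.
[folklore] -/
theorem loewnerInvAt_eq (t : ℝ≥0) (y : ℝ) (U : ℝ≥0 → ℝ) :
    loewnerInvAt t y U = Function.invFunOn (map U t) (domain U t) ((U t : ℂ) + I * y) := rfl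

/-- Perturbation of the truncated backward field in the driving function:
`|bwdField V - bwdField U| ≤ (2/m²) ε` if `|U - V| ≤ ε` on `[0, t]`. [folklore] -/
theorem norm_bwdField_sub_bwdField_le {U V : ℝ≥0 → ℝ} {t : ℝ≥0} {m : ℝ≥0} (hm : 0 < m)
    {ε : ℝ} (hUV : ∀ u : ℝ≥0, u ≤ t → |U u - V u| ≤ ε) {s : ℝ} (hs : s ∈ Icc (0 : ℝ) t) (x : ℂ) :
    ‖bwdField V t m s x - bwdField U t m s x‖ ≤ 2 / m ^ 2 * ε := by
  have hm' : (0 : ℝ) < m := hm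
  set p := liftIm (m : ℝ) x with hp
  set u : ℝ≥0 := (((t : ℝ) - s)).toNNReal with hu
  have hut : u ≤ t := by
    rw [hu, ← NNReal.coe_le_coe, Real.coe_toNNReal _ (by linarith [hs.2])]
    linarith [hs.1]
  have ha : (m : ℝ) ≤ ‖p - U u‖ := le_norm_sub_ofReal_of_le_im (le_im_liftIm _ _) _
  have hb : (m : ℝ) ≤ ‖p - V u‖ := le_norm_sub_ofReal_of_le_im (le_im_liftIm _ _) _
  have ha0 : p - U u ≠ 0 := norm_pos_iff.1 (hm'.trans_le ha)
  have hb0 : p - V u ≠ 0 := norm_pos_iff.1 (hm'.trans_le hb)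
  have hid : bwdField V t m s x - bwdField U t m s x =
      2 * ((U u : ℂ) - V u) / ((p - V u) * (p - U u)) := by
    simp only [bwdField_apply, ← hp, ← hu]
    field_simp
    ring
  rw [hid, norm_div, norm_mul, norm_mul, RCLike.norm_ofNat, ← Complex.ofReal_sub, Complex.norm_real,
    Real.norm_eq_abs]
  have hε : |U u - V u| ≤ ε := hUV u hut
  have hε0 : 0 ≤ ε := (abs_nonneg _).trans hε
  rw [div_le_iff₀ (by positivity)]
  have hprod : (m : ℝ) ^ 2 ≤ ‖p - V u‖ * ‖p - U u‖ := by
    rw [sq]; exact mul_le_mul hb ha hm'.le (norm_nonneg _)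
  calc 2 * |U u - V u| ≤ 2 * ε := by linarith
    _ = 2 / (m : ℝ) ^ 2 * ε * (m : ℝ) ^ 2 := by field_simp
    _ ≤ 2 / (m : ℝ) ^ 2 * ε * (‖p - V u‖ * ‖p - U u‖) := by gcongr

/-- **Stability of the backward Loewner flow in the driving function** (Grönwall): if `U, V`
are continuous and `|U - V| ≤ ε` on `[0, t]`, then
`|f^U_t(U t + iy) - f^V_t(V t + iy)| ≤ 2 e^{8t/y²} ε` (`y > 0`): both backward trajectories solve
the truncated backward field of `U` (`bwdField`, globally `2/m²`-Lipschitz, `m = y/2`) up to an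
error `2ε/m²`, with initial points `ε`-close; Mathlib `dist_le_of_approx_trajectories_ODE`.
A Grönwall estimate for the flow of Lawler (2005), Ch. 4 §4.1. [folklore] -/
theorem norm_loewnerInvAt_sub_le {U V : ℝ≥0 → ℝ} (hU : Continuous U) (hV : Continuous V)
    (t : ℝ≥0) {y : ℝ} (hy : 0 < y) {ε : ℝ} (hUV : ∀ u : ℝ≥0, u ≤ t → |U u - V u| ≤ ε) :
    ‖loewnerInvAt t y U - loewnerInvAt t y V‖ ≤ 2 * Real.exp (8 / y ^ 2 * t) * ε := by
  have hε0 : 0 ≤ ε := (abs_nonneg _).trans (hUV 0 (zero_le))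
  -- the common truncation level `m = y/2`
  set m : ℝ≥0 := ⟨y / 2, by positivity⟩ with hmdef
  have hm : 0 < m := by change (0 : ℝ) < y / 2; positivity
  have hm' : (m : ℝ) = y / 2 := rfl
  have hwU : (m : ℝ) < ((U t : ℂ) + I * y).im := by simp [hm']; linarith
  have hwV : (m : ℝ) < ((V t : ℂ) + I * y).im := by simp [hm']; linarith
  obtain ⟨hU', hU0, hUc, hUd, hUim, hUdom, hUmap⟩ := exists_backward_solution hU t hm hwU
  obtain ⟨hV', hV0, hVc, hVd, hVim, hVdom, hVmap⟩ := exists_backward_solution hV t hm hwV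
  have hΘU : loewnerInvAt t y U = hU' t :=
    invFunOn_map_eq hU (by change (0 : ℝ) < _; simp; linarith) hUdom hUmap
  have hΘV : loewnerInvAt t y V = hV' t :=
    invFunOn_map_eq hV (by change (0 : ℝ) < _; simp; linarith) hVdom hVmap
  rw [hΘU, hΘV, ← dist_eq_norm]
  -- both are (approximate) solutions of the truncated field of `U`
  set K : ℝ≥0 := 2 / m ^ 2 with hK
  have hKpos : (0 : ℝ) < K := by rw [hK]; push_cast; positivity
  have hderiv : ∀ {X : ℝ≥0 → ℝ} {h : ℝ → ℂ},
      (∀ s ∈ Icc (0 : ℝ) t, HasDerivWithinAt h (-vectorField X ((t : ℝ) - s) (h s))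
        (Icc (-1 : ℝ) t) s) →
      (∀ s ∈ Icc (0 : ℝ) t, (m : ℝ) ≤ (h s).im) →
      ∀ s ∈ Ico (0 : ℝ) t, HasDerivWithinAt h (bwdField X t m s (h s)) (Ici s) s := by
    intro X h hd him s hs
    have h1 := (hd s ⟨hs.1, hs.2.le⟩).mono (Icc_subset_Icc_left (by linarith [hs.1]) :
      Icc s (t : ℝ) ⊆ Icc (-1 : ℝ) t)
    have h2 := h1.mono_of_mem_nhdsWithin (Icc_mem_nhdsGE hs.2)
    rwa [bwdField, liftIm_of_le (him s ⟨hs.1, hs.2.le⟩)]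
  have hUim' : ∀ s ∈ Icc (0 : ℝ) t, (m : ℝ) ≤ (hU' s).im := fun s hs ↦ hwU.le.trans (hUim s hs)
  have hVim' : ∀ s ∈ Icc (0 : ℝ) t, (m : ℝ) ≤ (hV' s).im := fun s hs ↦ hwV.le.trans (hVim s hs)
  have key := dist_le_of_approx_trajectories_ODE (v := bwdField U t m) (K := K)
    (f := hU') (g := hV') (f' := fun s ↦ bwdField U t m s (hU' s))
    (g' := fun s ↦ bwdField V t m s (hV' s)) (a := 0) (b := t) (εf := 0) (εg := 2 / m ^ 2 * ε)
    (δ := ε) (fun s ↦ lipschitzWith_bwdField hm U t s) hUc.continuousOn (hderiv hUd hUim')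
    (fun s _ ↦ by simp) hVc.continuousOn (hderiv hVd hVim')
    (fun s hs ↦ by
      rw [dist_eq_norm]
      exact norm_bwdField_sub_bwdField_le hm hUV ⟨hs.1, hs.2.le⟩ (hV' s))
    (by
      rw [hU0, hV0, dist_eq_norm]
      have : ((U t : ℂ) + I * y) - ((V t : ℂ) + I * y) = ((U t - V t : ℝ) : ℂ) := by
        push_cast; ring
      rw [this, Complex.norm_real, Real.norm_eq_abs]
      exact hUV t le_rfl)
    t ⟨t.coe_nonneg, le_rfl⟩
  refine key.trans ?_
  rw [gronwallBound_of_K_ne_0 hKpos.ne', zero_add, sub_zero]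
  have hKm : (K : ℝ) = 8 / y ^ 2 := by
    rw [hK]; push_cast; rw [hm']; field_simp; ring
  simp only
  rw [show (2 : ℝ) / (m : ℝ) ^ 2 = K by rw [hK]; push_cast; ring, hKm]
  have hexp : 1 ≤ Real.exp (8 / y ^ 2 * t) := Real.one_le_exp (by positivity)
  have h8 : (0 : ℝ) < 8 / y ^ 2 := by positivity
  calc ε * Real.exp (8 / y ^ 2 * t) + 8 / y ^ 2 * ε / (8 / y ^ 2) * (Real.exp (8 / y ^ 2 * t) - 1)
      = ε * Real.exp (8 / y ^ 2 * t) + ε * (Real.exp (8 / y ^ 2 * t) - 1) := by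
        field_simp
    _ ≤ 2 * Real.exp (8 / y ^ 2 * t) * ε := by nlinarith

/-! ### Bernstein approximation of the driving function through finitely many values -/

/-- The **Bernstein driver** with node values `v : Fin (N+1) → ℝ` on the time scale `t`:
`u ↦ ∑ₖ bₖ^N(u/t) vₖ` (clamped to `[0, t]`), a continuous driving function depending
continuously (`1`-Lipschitz for the sup norms) on the finitely many numbers `vₖ`. [folklore] -/
def bernDriverFun (N : ℕ) (t : ℝ≥0) (v : Fin (N + 1) → ℝ) : ℝ≥0 → ℝ :=
  fun u ↦ ∑ k : Fin (N + 1), bernstein N k (projIcc (0 : ℝ) 1 zero_le_one ((u : ℝ) / t)) * v k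

/-- The Bernstein driver is continuous. [folklore] -/
theorem continuous_bernDriverFun (N : ℕ) (t : ℝ≥0) (v : Fin (N + 1) → ℝ) :
    Continuous (bernDriverFun N t v) := by
  refine continuous_finsetSum _ fun k _ ↦ Continuous.mul ?_ continuous_const
  exact (bernstein N k).continuous.comp (continuous_projIcc.comp
    (NNReal.continuous_coe.div_const _))

/-- The Bernstein driver is `1`-Lipschitz in the node values (the Bernstein polynomials form a
partition of unity). [folklore] -/
theorem abs_bernDriverFun_sub_le (N : ℕ) (t : ℝ≥0) (v v' : Fin (N + 1) → ℝ) (u : ℝ≥0) :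
    |bernDriverFun N t v u - bernDriverFun N t v' u| ≤ ‖v - v'‖ := by
  simp only [bernDriverFun, ← Finset.sum_sub_distrib, ← mul_sub]
  set x := projIcc (0 : ℝ) 1 zero_le_one ((u : ℝ) / t)
  calc |∑ k : Fin (N + 1), bernstein N k x * (v k - v' k)|
      ≤ ∑ k : Fin (N + 1), |bernstein N k x * (v k - v' k)| := Finset.abs_sum_le_sum_abs _ _
    _ ≤ ∑ k : Fin (N + 1), bernstein N k x * ‖v - v'‖ := by
        refine Finset.sum_le_sum fun k _ ↦ ?_
        rw [abs_mul, abs_of_nonneg bernstein_nonneg]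
        gcongr
        simpa [Real.norm_eq_abs] using norm_le_pi_norm (v - v') k
    _ = ‖v - v'‖ := by rw [← Finset.sum_mul, bernstein.probability, one_mul]

/-- The driving function on `[0, t]`, rescaled to the unit interval. [folklore] -/
def rescaleDriver (U : ℝ≥0 → ℝ) (hU : Continuous U) (t : ℝ≥0) : C(unitInterval, ℝ) :=
  ⟨fun s ↦ U (((t : ℝ) * s).toNNReal), hU.comp (continuous_real_toNNReal.comp
    (continuous_const.mul continuous_subtype_val))⟩

/-- The node values `U(tk/N)`. [folklore] -/
def bernNodes (N : ℕ) (t : ℝ≥0) (U : ℝ≥0 → ℝ) : Fin (N + 1) → ℝ :=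
  fun k ↦ U (((t : ℝ) * ((k : ℕ) / N : ℝ)).toNNReal)

/-- With the node values of `U`, the Bernstein driver is the Bernstein polynomial of the
rescaled driver. [folklore] -/
theorem bernDriverFun_bernNodes {U : ℝ≥0 → ℝ} (hU : Continuous U) (N : ℕ) (t : ℝ≥0) (u : ℝ≥0) :
    bernDriverFun N t (bernNodes N t U) u =
      bernsteinApproximation N (rescaleDriver U hU t) (projIcc (0 : ℝ) 1 zero_le_one ((u : ℝ) / t)) := by
  rw [bernsteinApproximation.apply]
  simp only [bernDriverFun, bernNodes, rescaleDriver, smul_eq_mul, ContinuousMap.coe_mk, bernstein.z]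

/-- **Uniform approximation of the driver by its Bernstein drivers** on `[0, t]`:
`|B_N U (u) - U u| ≤ ‖B_N Ũ - Ũ‖` (`Ũ` the rescaled driver), which tends to `0`
(Mathlib `bernsteinApproximation_uniform`). [folklore] -/
theorem abs_bernDriverFun_bernNodes_sub_le {U : ℝ≥0 → ℝ} (hU : Continuous U) (N : ℕ) (t : ℝ≥0)
    {u : ℝ≥0} (hu : u ≤ t) :
    |bernDriverFun N t (bernNodes N t U) u - U u| ≤
      ‖bernsteinApproximation N (rescaleDriver U hU t) - rescaleDriver U hU t‖ := by
  rw [bernDriverFun_bernNodes hU]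
  set x := projIcc (0 : ℝ) 1 zero_le_one ((u : ℝ) / t) with hx
  have hUu : rescaleDriver U hU t x = U u := by
    simp only [rescaleDriver, ContinuousMap.coe_mk, hx]
    congr 1
    rcases eq_or_ne t 0 with ht | ht
    · subst ht
      have : u = 0 := le_antisymm hu zero_le
      simp [this]
    · have h01 : (u : ℝ) / t ∈ Icc (0 : ℝ) 1 :=
        ⟨by positivity, (div_le_one (by positivity)).2 (by exact_mod_cast hu)⟩
      rw [projIcc_of_mem _ h01]
      simp only
      rw [mul_div_cancel₀ _ (by exact_mod_cast ht), Real.toNNReal_coe]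
  rw [← hUu, ← Real.norm_eq_abs, ← ContinuousMap.sub_apply]
  exact ContinuousMap.norm_coe_le_norm _ x

/-! ### Measurability of `ω ↦ fₜ(Wₜ(ω) + iy)` -/

/-- `v ↦ loewnerInvAt t y (Bernstein driver of v)` is Lipschitz, hence continuous. [folklore] -/
theorem continuous_loewnerInvAt_bernDriverFun (N : ℕ) (t : ℝ≥0) {y : ℝ} (hy : 0 < y) :
    Continuous fun v : Fin (N + 1) → ℝ ↦ loewnerInvAt t y (bernDriverFun N t v) := by
  refine (LipschitzWith.of_dist_le_mul (K := ⟨2 * Real.exp (8 / y ^ 2 * t), by positivity⟩)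
    fun v v' ↦ ?_).continuous
  rw [dist_eq_norm, dist_eq_norm]
  exact norm_loewnerInvAt_sub_le (continuous_bernDriverFun N t v) (continuous_bernDriverFun N t v')
    t hy fun u _ ↦ abs_bernDriverFun_sub_le N t v v' u

variable (κ : ℝ≥0)

/-- For each `N`, `ω ↦ loewnerInvAt t y (B_N W(ω))` is measurable: a continuous function of
the finitely many Brownian marginals `W_{tk/N}(ω)`. [folklore] -/
theorem measurable_loewnerInvAt_bernDriverFun_sleDriving (N : ℕ) (t : ℝ≥0) {y : ℝ} (hy : 0 < y) :
    Measurable fun ω ↦ loewnerInvAt t y (bernDriverFun N t (bernNodes N t (sleDriving κ ω))) := by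
  have hv : Measurable fun ω ↦ bernNodes N t (sleDriving κ ω) :=
    measurable_pi_lambda _ fun k ↦ measurable_sleDriving κ _
  exact (continuous_loewnerInvAt_bernDriverFun N t hy).measurable.comp hv

/-- **`ω ↦ fₜ(Wₜ + iy) = loewnerInvAt t y (W(ω))` is measurable** (Rohde–Schramm (2005), §3
p. 896: `f̂ₛ` is measurable with respect to `σ(ξ(u), u ≤ s)`): it is the everywhere limit, as
`N → ∞`, of the measurable maps `ω ↦ loewnerInvAt t y (B_N W(ω))` (stability of the backward
flow + uniform Bernstein approximation of the continuous path `W(ω)`).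
[cite: RohdeSchramm2005, §3 p. 896] -/
theorem measurable_loewnerInvAt_sleDriving (t : ℝ≥0) {y : ℝ} (hy : 0 < y) :
    Measurable fun ω ↦ loewnerInvAt t y (sleDriving κ ω) := by
  refine measurable_of_tendsto_metrizable
    (fun N ↦ measurable_loewnerInvAt_bernDriverFun_sleDriving κ N t hy) (tendsto_pi_nhds.2 fun ω ↦ ?_)
  set U := sleDriving κ ω with hU
  have hUc : Continuous U := continuous_sleDriving κ ω
  rw [tendsto_iff_norm_sub_tendsto_zero]
  have hbern := bernsteinApproximation_uniform (rescaleDriver U hUc t)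
  rw [tendsto_iff_norm_sub_tendsto_zero] at hbern
  refine squeeze_zero (fun N ↦ norm_nonneg _) (fun N ↦ norm_loewnerInvAt_sub_le
    (continuous_bernDriverFun N t _) hUc t hy fun u hu ↦ abs_bernDriverFun_bernNodes_sub_le hUc N t hu) ?_
  simpa using hbern.const_mul (2 * Real.exp (8 / y ^ 2 * t))

end Loewner

/-! ### The named fact `aemeasurable_sleTrace` and existence of SLE from the trace theorems -/

/-- **`Literature.Probability.RandomPlanarGeometry.aemeasurable_sleTrace` holds**: if SLE_κ is a.s. generated by a curve, the marginals
`ω ↦ sleTrace κ ω t` are a.e.-measurable. On the a.s. event of generation the trace is the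
boundary limit `γ(t) = limₙ fₜ(Wₜ + i/(n+1)) = limₙ loewnerInvAt t (1/(n+1)) W`
(`IsGeneratedByCurve.tendsto_invFunOn_map_seq`) of measurable maps
(`measurable_loewnerInvAt_sleDriving`). Rohde–Schramm (2005), §3 p. 896 with Thm. 5.1 / Thm. 4.1.
[cite: RohdeSchramm2005, §3 p. 896] -/
theorem aemeasurable_sleTrace_holds : aemeasurable_sleTrace := by
  intro κ h t
  refine aemeasurable_of_tendsto_metrizable_ae' (f := fun n ω ↦
    Loewner.loewnerInvAt t ((1 : ℝ) / (n + 1)) (sleDriving κ ω))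
    (fun n ↦ (Loewner.measurable_loewnerInvAt_sleDriving κ t (by positivity)).aemeasurable) ?_
  filter_upwards [h] with ω hω
  have hgen := Loewner.isGeneratedByCurve_trace hω
  exact hgen.tendsto_invFunOn_map_seq (continuous_sleDriving κ ω) t

/-- **Existence of chordal SLE_κ as a random curve, from the three SLE trace theorems alone.**
`Literature.Probability.RandomPlanarGeometry.exists_isSLECurve` (for every `κ > 0` and every Dobrushin domain `(D; a, b)` there is an
a.e.-measurable random curve `Γ` with `IsSLECurve κ D Γ`) follows from: SLE₈ is generated by a
curve (`hasSLETrace_eight`, Lawler–Schramm–Werner (2004), Thm. 4.7), SLE_κ is generated by a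
curve for `κ ≠ 8` (`hasSLETrace_of_ne_eight`, Rohde–Schramm (2005), Thm. 5.1) and transience of
the trace (`tendsto_norm_sleTrace_atTop`, Rohde–Schramm (2005), Thm. 7.1). Everything else —
the Riemann mapping theorem, Carathéodory's continuity theorem (via length–area and
Janiszewski), simple connectivity of Jordan domains (via Runge), conformality and the backward
flow of the Loewner equation, strict growth of the hulls, the identification of the tip as the
boundary limit of `gₜ⁻¹`, and measurability of the trace — is proved in this library.
[cite: RohdeSchramm2005, Thm 5.1 and Thm 7.1] -/
theorem exists_isSLECurve_of_trace_theorems (h8 : hasSLETrace_eight) (hne : hasSLETrace_of_ne_eight)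
    (htr : tendsto_norm_sleTrace_atTop) : exists_isSLECurve :=
  exists_isSLECurve_of_sle_facts h8 hne htr aemeasurable_sleTrace_holds

end Literature.Probability.RandomPlanarGeometry
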